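import Literature.Probability.RandomPlanarGeometry.HexSAWArmchairSqrtAsymptotic
import Literature.Probability.RandomPlanarGeometry.HexSAWRotSurfaceArmchairDictionary
import Literature.Probability.RandomPlanarGeometry.HexSAWRotSurfaceMuSqrtAsymptotic
import Literature.Probability.RandomPlanarGeometry.HexSAWArmchairSqrtStrict
import Mathlib.Analysis.MeanInequalities
import Mathlib.Analysis.Convex.Slope
import Mathlib.Analysis.Convex.Deriv
import HarnessLib

/-!
# The armchair wall-bridge rate of honeycomb SAW at Beaton's ROTATED surface: `β_rot(y)` is non-decreasing and log-convex in
# `log y`, `½`-Lipschitz in `log y` — `β_rot(y) ≤ β_rot(y') ≤ √(y'/y) · β_rot(y)` for `0 < y ≤ y'` —, hence continuous; and the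
# same chord bound for Beaton's `μ(y) = max(β_rot(y), μ)`

Topic `Literature/Probability/RandomPlanarGeometry` (lane «pcv-sawmu», rotated-door lineage; continues `HexSAWArmchairWallBridges.lean`
— armchair wall bridges `wb n`, their weights `WB n y = Σ y^{visits}`, the supermultiplicative sequence `wseq y k = WB (4k−3) y`, its Fekete
data `armU`, `armLogLim`, `tendsto_armU_div`, and the rate `armRate y = β_rot(y) = exp(−ℓ(y)/4)` —, `HexSAWArmchairSqrtAsymptotic.lean`
(`tendsto_log_armRate_sub_half_log : log β_rot(y) − ½ log y → 0`) and `HexSAWRotSurfaceArmchairDictionary.lean`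
(`rotSurfaceMu y = max (armRate y) μ`).  It is the ARMCHAIR-frame twin of the zig-zag-wall file `HexSAWSurfaceWallRateSqrtMonotone.lean`
(a-p5 g12), with one difference of method: the a priori parity bound `β ≤ μ √max(1,y)` used there is replaced here by the finer input
`β_rot(y)/√y → 1` already in the tree, so no visit-density count is needed.

Sources.  N. R. Beaton, *The critical surface fugacity of self-avoiding walks on a rotated honeycomb lattice*, J. Phys. A 47 (2014)
075003 = arXiv:1210.0274v3, §3.1, Proposition 7 (p. 11: "`μ(y)` … exists and is finite. It is a log-convex, non-decreasing function of
`log y`, and therefore continuous and almost everywhere differentiable. … Moreover, for any `y > 0`, `μ(y) ≥ max{μ, √y}`"; proof p. 14: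
"The other results are elementary, and follow from a paper of Whittington"), where `μ(y) = lim_n C⁺_n(y)^{1/n}` is the rotated
half-plane rate — in this tree `rotSurfaceMu y = max (armRate y) μ` (`HexSAWRotSurfaceArmchairDictionary.lean`,
`HexSAWRotSurfaceYcLimitAllY.lean`).  J. M. Hammersley, G. M. Torrie, S. G. Whittington, *Self-avoiding walks interacting with a
surface*, J. Phys. A 15 (1982) 539–571, §2 (log-convexity of surface free energies by Hölder's inequality on the partition functions;
monotonicity).  N. Madras, G. Slade, *The Self-Avoiding Walk* (1993), §1.2, Lemma 1.2.2 (Fekete).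

What is proved here (namespace `Literature.Probability.RandomPlanarGeometry.SAW.HexBW.Arm`, all PROVED, no hypotheses beyond `0 < y`):

* (`WB_mono`, private) `wseq_mono`, `armLogLim_le_of_wseq_le`, **`armRate_mono`**, `monotoneOn_armRate` — `β_rot` is non-decreasing on `(0, ∞)`;
* (`WB_rpow_mul_rpow_le`, private) `wseq_rpow_mul_rpow_le` (Hölder on the finite sums), **`armRate_rpow_mul_rpow_le`** —
  `β_rot(y₁^θ y₂^{1−θ}) ≤ β_rot(y₁)^θ β_rot(y₂)^{1−θ}` (`0 < θ < 1`), **`convexOn_log_armRate_exp`** — `t ↦ log β_rot(eᵗ)` is convex on `ℝ`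
  (Proposition 7's "log-convex … function of `log y`", for the wall-bridge rate);
* `exists_log_armRate_exp_le` (`log β_rot(eᵗ) ≤ 1 + t/2` for `t ≥ T`), `log_armRate_exp_sub_le` — every chord of `t ↦ log β_rot(eᵗ)` has
  slope `≤ ½` (a convex function whose difference from `t/2` tends to `0` has no chord steeper than `½`),
  **`armRate_le_sqrt_div_mul : 0 < y ≤ y' → β_rot(y') ≤ √(y'/y) · β_rot(y)`**, `antitoneOn_armRate_div_sqrt` (`β_rot(y)/√y` is NON-INCREASING
  on `(0,∞)` — and tends to `1`, so in particular `β_rot(y) ≥ √y` is recovered), `log_armRate_sub_log_armRate_mem_Icc`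
  (`0 ≤ log β_rot(y') − log β_rot(y) ≤ (log y' − log y)/2`);
* **`continuousOn_armRate : ContinuousOn armRate (Set.Ioi 0)`** (squeeze between the two chord bounds) and
  `ae_differentiableAt_armRate` (Lebesgue, from monotonicity) — Proposition 7's "continuous and almost everywhere differentiable" for
  `β_rot`, WITHOUT the identification `μ(y) = β_rot(y)` of the door files;
* for Beaton's `μ(y)` itself in the dictionary form `rotSurfaceMu y = max (armRate y) μ`: **`rotSurfaceMu_le_sqrt_div_mul :
  0 < y ≤ y' → μ(y') ≤ √(y'/y) · μ(y)`** and `antitoneOn_rotSurfaceMu_div_sqrt` — sharper than the ratio bound `μ(y') ≤ (y'/y) μ(y)` of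
  Hammersley–Torrie–Whittington type;
* (EDITION 3, appended section) Proposition 7's clauses 2–4 for `μ(y) = max(β_rot(y), μ)` DOOR-FREE: `HV.rotSurfaceMu_rpow_mul_rpow_le`
  (`μ(y₁^θ y₂^{1−θ}) ≤ μ(y₁)^θ μ(y₂)^{1−θ}`, `0 ≤ θ ≤ 1`), **`HV.convexOn_log_rotSurfaceMu_exp`** ("log-convex … function of `log y`"),
  **`HV.monotoneOn_rotSurfaceMu`** ("non-decreasing"), **`HV.continuousOn_rotSurfaceMu`** ("therefore continuous") and
  **`HV.ae_differentiableAt_rotSurfaceMu`** ("almost everywhere differentiable") — the maximum of two log-convex, non-decreasing,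
  continuous functions is such.  With the tree's `HexSAWRotSurfaceYcLimitAllY` (`C⁺_n(y)^{1/n} → rotSurfaceMu y`) these ARE the printed
  clauses about Beaton's limit `μ(y)`;  and the SURFACE DENSITY WINDOW: `HV.log_rotSurfaceMu_sub_mem_Icc` (`0 ≤ log μ(y') − log μ(y) ≤
  (log y' − log y)/2`), **`Arm.mul_deriv_div_armRate_mem_Icc`**, **`HV.mul_deriv_div_rotSurfaceMu_mem_Icc`** — wherever `β_rot` resp. `μ(y)`
  is differentiable (a.e.), the logarithmic derivative `y f'(y)/f(y)` (the density of adsorbed vertices) lies in `[0, ½]`;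
* (EDITION 6) **`Arm.exists_one_sided_deriv_log_armRate_exp`**: at EVERY `t` the convex free energy `t ↦ log β_rot(eᵗ)` has a left
  derivative `ρ⁻` and a right derivative `ρ⁺` with `0 ≤ ρ⁻ ≤ ρ⁺ ≤ ½` (one-sided densities exist at every fugacity, transition included).
* (EDITION 7) the one-sided SURFACE DENSITIES as functions of `t = log y`: `Arm.armFreeEnergy t = κ_rot(t) := log β_rot(eᵗ)`,
  `Arm.armRightDensity t = ρ⁺(t) := d⁺κ_rot/dt`, `Arm.armLeftDensity t = ρ⁻(t) := d⁻κ_rot/dt` (Mathlib's one-sided `derivWithin` of the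
  convex `κ_rot`; `hasDerivWithinAt_armRightDensity` / `…Left…`), `armDensities_mem_Icc` (`0 ≤ ρ⁻ ≤ ρ⁺ ≤ ½`), `monotone_armRightDensity` /
  `monotone_armLeftDensity`, the interlacing `armRightDensity_le_armLeftDensity_of_lt` (`ρ⁺(t) ≤ ρ⁻(t')`, `t < t'`), the density
  identity `armRightDensity_eq_of_differentiableAt` (`ρ±(t) = y β_rot'(y)/β_rot(y)` wherever `β_rot` is differentiable at `y = eᵗ`), and
  **SATURATION**: `half_sub_le_armLeftDensity` (**`½ − 109e·e^{−t/2} ≤ ρ⁻(t)`** for `t ≥ 2 + 2 log 218`, from the tree's window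
  `β_rot(y) ≤ √y/(1 − 109/√y)`), **`tendsto_armLeftDensity_atTop` / `tendsto_armRightDensity_atTop` (`ρ±(t) → ½`)** — at large fugacity
  one vertex in two of a long armchair wall bridge is a wall vertex, the most the armchair boundary allows —, and the same limits for
  the one-sided densities of Beaton's `μ(y)` (`HV.derivWithin_Ioi_log_rotSurfaceMu_exp_eq`, `HV.tendsto_derivWithin_Ioi_log_rotSurfaceMu_exp_atTop`,
  `…Iio…`; `μ(y) = β_rot(y)` for `y ≥ 4`); and STRICTNESS: `slope_armFreeEnergy_lt_half` (no chord of `κ_rot` has slope `½`), hence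
  **`armRate_lt_sqrt_div_mul : 0 < y < y' → β_rot(y') < √(y'/y)·β_rot(y)`**, `strictAntiOn_armRate_div_sqrt` (`β_rot(y)/√y ↓ 1` STRICTLY),
  **`armRightDensity_lt_half : ρ⁺(t) < ½` at EVERY `t`** (no saturation at a finite fugacity), `HV.rotSurfaceMu_lt_sqrt_div_mul`,
  `HV.strictAntiOn_rotSurfaceMu_div_sqrt` (input: `√y < β_rot(y)` of `HexSAWArmchairSqrtStrict`).  The hypercubic analogue (`𝓔_±(a) → 1` by convexity, from Janse van Rensburg–Whittington
  2013 §3.1 Corollary 1 / Theorem 5: `κ(a) ∼ log μ_{d−1} + log a`) is `SAWAdsorptionDensity.lean`; here the saturation value is `½`, the armchair wall carrying at most every other vertex of a walk.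

Status in print / LABEL (author's proposal, for the literature seats): the monotonicity, log-convexity, continuity and a.e.
differentiability clauses are PRINTED for `μ(y)` (Beaton, Prop. 7, p. 11, "elementary … follow from [Whittington]") and are proved here
for the wall-bridge rate `β_rot(y)` by the printed mechanism (Hölder + Fekete) — CONSOLIDATION; the chord bound
`β_rot(y') ≤ √(y'/y) β_rot(y)` / `μ(y') ≤ √(y'/y) μ(y)` (exponent `½`, every `0 < y ≤ y'`) is an elementary consequence of log-convexity and
the order `√y` at infinity which we have not found stated for the honeycomb surface models — lane corollary, NEW-IN-WRITING (modest) at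
most, the armchair twin of `Wall.wallRate_le_sqrt_mul`.  Not claimed: strict monotonicity (false below `y†`, where `β_rot = μ`), any
statement at `y = y†`, differentiability everywhere.  EDITION 7's densities: the definitions and the window/monotonicity/interlacing
clauses are the printed convexity bookkeeping (CONSOLIDATION, hypercubic wording of Janse van Rensburg–Whittington 2013 §3.1 eq. (3.4));
the saturation `ρ±(t) → ½` with the deficit `O(e^{−t/2}) = O(y^{−1/2})` is a lane corollary of `β_rot(y)/√y → 1` and log-convexity which we
have not found printed for the honeycomb surface models (XS).
EDITIONS: ed.1 35b58faf565839d5; ed.2 cf71d50e7fd13233 = ed.1 with TWO declarations renamed (`armRate_le_sqrt_mul` → `armRate_le_sqrt_div_mul`,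
`rotSurfaceMu_le_sqrt_mul` → `rotSurfaceMu_le_sqrt_div_mul`) to keep the names `HV.rotSurfaceMu_le_sqrt_mul` / `HV.armRate_le_sqrt_mul` free
for the banked rider G `HexSAWRotSurfaceSqrtUpper.lean` (`μ_rot(y) ≤ √y·μ`); statements and proofs otherwise byte-identical; ed.3 (this) =
ed.2 byte-identical ⊕ the appended section «Proposition 7, clauses 2–4, for μ(y) = max(β_rot(y), μ)» (5 theorems) and this header bullet;
ed.4 = ed.3 byte-identical ⊕ the appended subsection «surface density window» (3 theorems + 1 private lemma); ed.5 = ed.4 with the two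
finite-sum lemmas `WB_mono`, `WB_rpow_mul_rpow_le` made `private` (the gate's `dedup.landed` lint, textual on public statements, matched them
with the zig-zag-wall twins `Wall.WB_mono` / `Wall.WB_rpow_mul_rpow_le` of `HexSAWSurfaceWallRateSqrtMonotone.lean`, landed after edition 2 —
different `WB` constants, same printed shape); every other byte of the code unchanged; ed.6 = ed.5 (landed p375852) byte-identical ⊕
the appended section «one-sided densities exist at every fugacity» (`Arm.exists_one_sided_deriv_log_armRate_exp` + 3 private lemmas);
ed.7 (this) = ed.6 (landed p377353) with every declaration byte-identical, three imports added (`HexSAWRotSurfaceMuSqrtAsymptotic` for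
`μ(y) = β_rot(y)` (`y ≥ 4`), `HexSAWArmchairSqrtStrict` for `√y < β_rot(y)`, `Mathlib.Analysis.Convex.Deriv` for the one-sided derivatives of convex functions) ⊕ the appended section
«EDITION 7 — surface densities and saturation» (3 definitions, 36 theorems) and this header's EDITION 7 bullet / label sentence.
-/

noncomputable section

open Finset Filter Function
open Literature.Probability.LatticeModels Literature.Probability.Percolation SimpleGraph
open _root_.Topology

namespace Literature.Probability.RandomPlanarGeometry.SAW.HexBW.Arm

variable {y : ℝ} {n : ℕ}

/-! ### Monotonicity in `y` -/

/-- `B^w_n(y)` is non-decreasing in `y ≥ 0` (every summand `y^{visits}` is).  (Private since edition 5: the statement is a textual twin of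
`Wall.WB_mono` in `HexSAWSurfaceWallRateSqrtMonotone.lean` — a different `WB` — and the gate's dedup lint compares public statements textually.)
[cite: Beaton2014RotatedHoneycomb, §3.1, Proposition 7 (arXiv v3 p. 11: "non-decreasing")] -/
private theorem WB_mono (n : ℕ) (hy : 0 ≤ y) {y' : ℝ} (hyy' : y ≤ y') : WB n y ≤ WB n y' :=
  Finset.sum_le_sum fun _ _ => pow_le_pow_left₀ hy hyy' _

/-- `d_k(y) = B^w_{4k−3}(y)` is non-decreasing in `y ≥ 0`. [cite: Beaton2014RotatedHoneycomb, §3.1, Proposition 7 (arXiv v3 p. 11: "non-decreasing")] -/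
theorem wseq_mono (k : ℕ) (hy : 0 ≤ y) {y' : ℝ} (hyy' : y ≤ y') : wseq y k ≤ wseq y' k := by
  unfold wseq
  split_ifs
  · exact le_rfl
  · exact WB_mono _ hy hyy'

/-- Comparison of Fekete limits: if `d_k(y) ≤ d_k(y')` for every `k ≥ 1` then `ℓ(y') ≤ ℓ(y)`.
[cite: MadrasSlade1993, §1.2, Lemma 1.2.2] -/
theorem armLogLim_le_of_wseq_le {y y' : ℝ} (hy : 0 < y) (hy' : 0 < y')
    (h : ∀ k : ℕ, 1 ≤ k → wseq y k ≤ wseq y' k) : armLogLim y' ≤ armLogLim y := by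
  refine le_of_tendsto_of_tendsto (tendsto_armU_div hy') (tendsto_armU_div hy) ?_
  filter_upwards [Filter.eventually_ge_atTop 1] with k hk
  have hk' : (0 : ℝ) < k := by exact_mod_cast hk
  apply div_le_div_of_nonneg_right _ hk'.le
  simp only [armU]
  have := Real.log_le_log (wseq_pos hy k) (h k hk)
  linarith

/-- **`β_rot` is non-decreasing**: `0 < y ≤ y' → β_rot(y) ≤ β_rot(y')`.
[cite: Beaton2014RotatedHoneycomb, §3.1, Proposition 7 (arXiv v3 p. 11: "a log-convex, non-decreasing function of log y"); HammersleyTorrieWhittington1982, §2] -/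
theorem armRate_mono (hy : 0 < y) {y' : ℝ} (hyy' : y ≤ y') : armRate y ≤ armRate y' := by
  have hy' : 0 < y' := lt_of_lt_of_le hy hyy'
  have h := armLogLim_le_of_wseq_le hy hy' fun k _ => wseq_mono k hy.le hyy'
  unfold armRate
  exact Real.exp_le_exp.2 (by linarith)

/-- `β_rot` is monotone on `(0, ∞)`. [cite: Beaton2014RotatedHoneycomb, §3.1, Proposition 7 (arXiv v3 p. 11: "non-decreasing")] -/
theorem monotoneOn_armRate : MonotoneOn armRate (Set.Ioi 0) := fun _ hy _ _ hyy' => armRate_mono hy hyy'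

/-! ### Hölder: log-convexity in `log y` -/

/-- **Hölder on the wall-bridge sums**: `B^w_n(y₁^θ y₂^{1−θ}) ≤ B^w_n(y₁)^θ · B^w_n(y₂)^{1−θ}` for `0 < θ < 1`.  (Private since edition 5,
for the same reason as `WB_mono`: textual twin of `Wall.WB_rpow_mul_rpow_le`.)
[cite: HammersleyTorrieWhittington1982, §2; Beaton2014RotatedHoneycomb, §3.1, Proposition 7 (arXiv v3 p. 11: "log-convex")] -/
private theorem WB_rpow_mul_rpow_le (n : ℕ) {y₁ y₂ θ : ℝ} (h₁ : 0 < y₁) (h₂ : 0 < y₂) (hθ0 : 0 < θ) (hθ1 : θ < 1) :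
    WB n (y₁ ^ θ * y₂ ^ (1 - θ)) ≤ WB n y₁ ^ θ * WB n y₂ ^ (1 - θ) := by
  have hθ' : 0 < 1 - θ := by linarith
  set f : (ℕ → Site 2) → ℝ := fun ω => (y₁ ^ visits n ω) ^ θ with hf
  set g : (ℕ → Site 2) → ℝ := fun ω => (y₂ ^ visits n ω) ^ (1 - θ) with hg
  have hf0 : ∀ ω, 0 ≤ f ω := fun ω => Real.rpow_nonneg (pow_nonneg h₁.le _) _
  have hg0 : ∀ ω, 0 ≤ g ω := fun ω => Real.rpow_nonneg (pow_nonneg h₂.le _) _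
  have hterm : ∀ ω : ℕ → Site 2, (y₁ ^ θ * y₂ ^ (1 - θ)) ^ visits n ω = f ω * g ω := by
    intro ω
    rw [hf, hg]; simp only
    rw [mul_pow, ← Real.rpow_natCast (y₁ ^ θ), ← Real.rpow_natCast (y₂ ^ (1 - θ)),
      ← Real.rpow_mul h₁.le, ← Real.rpow_mul h₂.le, mul_comm θ, mul_comm (1 - θ),
      Real.rpow_mul h₁.le, Real.rpow_mul h₂.le, Real.rpow_natCast, Real.rpow_natCast]
  have hpq : (θ⁻¹).HolderConjugate (1 - θ)⁻¹ := Real.HolderConjugate.inv_one_sub_inv hθ0 hθ1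
  have hH := Real.inner_le_Lp_mul_Lq_of_nonneg (wb n) (f := f) (g := g) hpq (fun ω _ => hf0 ω) (fun ω _ => hg0 ω)
  have hfp : ∀ ω, f ω ^ θ⁻¹ = y₁ ^ visits n ω := fun ω => by
    rw [hf]; simp only
    rw [← Real.rpow_mul (pow_nonneg h₁.le _), mul_inv_cancel₀ hθ0.ne', Real.rpow_one]
  have hgq : ∀ ω, g ω ^ (1 - θ)⁻¹ = y₂ ^ visits n ω := fun ω => by
    rw [hg]; simp only
    rw [← Real.rpow_mul (pow_nonneg h₂.le _), mul_inv_cancel₀ hθ'.ne', Real.rpow_one]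
  unfold WB
  rw [Finset.sum_congr rfl fun ω _ => hterm ω]
  rw [Finset.sum_congr rfl fun ω _ => hfp ω, Finset.sum_congr rfl fun ω _ => hgq ω, one_div, one_div,
    inv_inv, inv_inv] at hH
  exact hH

/-- Hölder for the shifted sequence: `d_k(y₁^θ y₂^{1−θ}) ≤ d_k(y₁)^θ · d_k(y₂)^{1−θ}`.
[cite: HammersleyTorrieWhittington1982, §2; MadrasSlade1993, §1.2, Lemma 1.2.2] -/
theorem wseq_rpow_mul_rpow_le (k : ℕ) {y₁ y₂ θ : ℝ} (h₁ : 0 < y₁) (h₂ : 0 < y₂) (hθ0 : 0 < θ) (hθ1 : θ < 1) :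
    wseq (y₁ ^ θ * y₂ ^ (1 - θ)) k ≤ wseq y₁ k ^ θ * wseq y₂ k ^ (1 - θ) := by
  unfold wseq
  split_ifs with hk
  · rw [Real.one_rpow, Real.one_rpow, mul_one]
  · exact WB_rpow_mul_rpow_le (4 * k - 3) h₁ h₂ hθ0 hθ1

/-- **`β_rot` is log-convex in `log y`**: `β_rot(y₁^θ y₂^{1−θ}) ≤ β_rot(y₁)^θ · β_rot(y₂)^{1−θ}` for `0 < θ < 1`.
[cite: Beaton2014RotatedHoneycomb, §3.1, Proposition 7 (arXiv v3 p. 11: "a log-convex … function of log y"); HammersleyTorrieWhittington1982, §2] -/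
theorem armRate_rpow_mul_rpow_le {y₁ y₂ θ : ℝ} (h₁ : 0 < y₁) (h₂ : 0 < y₂) (hθ0 : 0 < θ) (hθ1 : θ < 1) :
    armRate (y₁ ^ θ * y₂ ^ (1 - θ)) ≤ armRate y₁ ^ θ * armRate y₂ ^ (1 - θ) := by
  have hθ' : 0 < 1 - θ := by linarith
  have hy : 0 < y₁ ^ θ * y₂ ^ (1 - θ) := mul_pos (Real.rpow_pos_of_pos h₁ _) (Real.rpow_pos_of_pos h₂ _)
  -- compare the Fekete limits: `θ ℓ(y₁) + (1−θ) ℓ(y₂) ≤ ℓ(y₁^θ y₂^{1−θ})`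
  have hlim : θ * armLogLim y₁ + (1 - θ) * armLogLim y₂ ≤ armLogLim (y₁ ^ θ * y₂ ^ (1 - θ)) := by
    refine le_of_tendsto_of_tendsto (((tendsto_armU_div h₁).const_mul θ).add
      ((tendsto_armU_div h₂).const_mul (1 - θ))) (tendsto_armU_div hy) ?_
    filter_upwards [Filter.eventually_ge_atTop 1] with k hk
    have hk' : (0 : ℝ) < k := by exact_mod_cast hk
    rw [← mul_div_assoc, ← mul_div_assoc, ← add_div]
    apply div_le_div_of_nonneg_right _ hk'.le
    simp only [armU]
    have hW := wseq_rpow_mul_rpow_le k h₁ h₂ hθ0 hθ1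
    have hlog := Real.log_le_log (wseq_pos hy k) hW
    rw [Real.log_mul (Real.rpow_pos_of_pos (wseq_pos h₁ k) _).ne' (Real.rpow_pos_of_pos (wseq_pos h₂ k) _).ne',
      Real.log_rpow (wseq_pos h₁ k), Real.log_rpow (wseq_pos h₂ k)] at hlog
    linarith
  unfold armRate
  rw [← Real.exp_mul, ← Real.exp_mul, ← Real.exp_add]
  exact Real.exp_le_exp.2 (by nlinarith)

/-- **`t ↦ log β_rot(eᵗ)` is convex on `ℝ`** ("log-convex … function of `log y`", for the armchair wall-bridge rate).
[cite: Beaton2014RotatedHoneycomb, §3.1, Proposition 7 (arXiv v3 p. 11: "It is a log-convex, non-decreasing function of log y")] -/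
theorem convexOn_log_armRate_exp : ConvexOn ℝ Set.univ (fun t : ℝ => Real.log (armRate (Real.exp t))) := by
  refine ⟨convex_univ, fun x _ z _ a b ha hb hab => ?_⟩
  simp only [smul_eq_mul]
  rcases ha.eq_or_lt with rfl | ha'
  · simp only [zero_mul, zero_add] at hab ⊢; subst hab; simp
  rcases hb.eq_or_lt with rfl | hb'
  · simp only [zero_mul, add_zero] at hab ⊢; subst hab; simp
  have ha1 : a < 1 := by linarith
  have hb_eq : b = 1 - a := by linarith
  subst hb_eq
  have hexp : Real.exp (a * x + (1 - a) * z) = Real.exp x ^ a * Real.exp z ^ (1 - a) := by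
    rw [Real.exp_add, mul_comm a x, mul_comm (1 - a) z, Real.exp_mul, Real.exp_mul]
  rw [hexp]
  have h := armRate_rpow_mul_rpow_le (Real.exp_pos x) (Real.exp_pos z) ha' ha1
  have hlog := Real.log_le_log (armRate_pos _) h
  rw [Real.log_mul (Real.rpow_pos_of_pos (armRate_pos _) _).ne' (Real.rpow_pos_of_pos (armRate_pos _) _).ne',
    Real.log_rpow (armRate_pos _), Real.log_rpow (armRate_pos _)] at hlog
  exact hlog

/-! ### Chords of slope at most `½`: `β_rot(y') ≤ √(y'/y) β_rot(y)` -/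

/-- Far out, the convex function `t ↦ log β_rot(eᵗ)` lies below the line `1 + t/2` (from `log β_rot(y) − ½ log y → 0`).
[cite: Beaton2014RotatedHoneycomb, §3.1, Proposition 7 (arXiv v3 p. 11: "μ(y) ≥ max{μ, √y}", with the matching upper order from `HexSAWArmchairSqrtAsymptotic`)] -/
theorem exists_log_armRate_exp_le : ∃ T : ℝ, ∀ t : ℝ, T ≤ t → Real.log (armRate (Real.exp t)) ≤ 1 + t / 2 := by
  have h1 : ∀ᶠ y : ℝ in atTop, Real.log (armRate y) - Real.log y / 2 < 1 :=
    tendsto_log_armRate_sub_half_log.eventually (gt_mem_nhds one_pos)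
  have h2 : ∀ᶠ t : ℝ in atTop, Real.log (armRate (Real.exp t)) - Real.log (Real.exp t) / 2 < 1 :=
    Real.tendsto_exp_atTop.eventually h1
  obtain ⟨T, hT⟩ := Filter.eventually_atTop.1 h2
  refine ⟨T, fun t ht => ?_⟩
  have h := hT t ht
  rw [Real.log_exp] at h
  linarith

/-- **Every chord of `t ↦ log β_rot(eᵗ)` has slope at most `½`.**
[cite: Beaton2014RotatedHoneycomb, §3.1, Proposition 7 (arXiv v3 p. 11: log-convexity); HammersleyTorrieWhittington1982, §2] -/
theorem log_armRate_exp_sub_le {t t' : ℝ} (htt' : t ≤ t') :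
    Real.log (armRate (Real.exp t')) - Real.log (armRate (Real.exp t)) ≤ (t' - t) / 2 := by
  rcases htt'.eq_or_lt with rfl | hlt
  · simp
  obtain ⟨T, hT⟩ := exists_log_armRate_exp_le
  set f : ℝ → ℝ := fun s => Real.log (armRate (Real.exp s)) with hfdef
  have hconv : ConvexOn ℝ Set.univ f := convexOn_log_armRate_exp
  by_contra hcon
  have hcon' : (t' - t) / 2 < f t' - f t := lt_of_not_ge hcon
  -- the slope `m₀ > 1/2` of the chord `[t, t']`
  set m₀ := (f t' - f t) / (t' - t) with hm₀
  have hpos : 0 < t' - t := sub_pos.2 hlt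
  have hm : 1 / 2 < m₀ := by
    rw [hm₀, lt_div_iff₀ hpos]
    linarith
  -- every later chord `[t', z]` has slope `≥ m₀`, so `f z ≥ f t' + m₀ (z − t')`; but `f z ≤ 1 + z/2` for `z ≥ T`
  set K := 1 + m₀ * t' - f t' with hK
  set z := max (max t' T) ((K + 1) / (m₀ - 1 / 2)) + 1 with hz
  have hzt' : t' < z := by
    have : t' ≤ max (max t' T) ((K + 1) / (m₀ - 1 / 2)) := (le_max_left _ _).trans (le_max_left _ _)
    linarith
  have hzT : T ≤ z := by
    have : T ≤ max (max t' T) ((K + 1) / (m₀ - 1 / 2)) := (le_max_right _ _).trans (le_max_left _ _)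
    linarith
  have hzK : (K + 1) / (m₀ - 1 / 2) < z := by
    have : (K + 1) / (m₀ - 1 / 2) ≤ max (max t' T) ((K + 1) / (m₀ - 1 / 2)) := le_max_right _ _
    linarith
  have hslope := hconv.slope_mono_adjacent (Set.mem_univ t) (Set.mem_univ z) hlt hzt'
  have hzt : 0 < z - t' := sub_pos.2 hzt'
  have h1 : m₀ * (z - t') ≤ f z - f t' := by
    rw [hm₀]; exact (le_div_iff₀ hzt).1 hslope
  have h2 : f z ≤ 1 + z / 2 := hT z hzT
  have h3 : (m₀ - 1 / 2) * z ≤ K := by rw [hK]; linarith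
  have hm' : 0 < m₀ - 1 / 2 := by linarith
  rw [div_lt_iff₀ hm'] at hzK
  linarith

/-- **`β_rot(y') ≤ √(y'/y) · β_rot(y)` for `0 < y ≤ y'`**: the armchair wall-bridge rate grows at most like `√y`, uniformly.
[cite: Beaton2014RotatedHoneycomb, §3.1, Proposition 7 (arXiv v3 p. 11: log-convexity and "μ(y) ≥ max{μ, √y}")] -/
theorem armRate_le_sqrt_div_mul (hy : 0 < y) {y' : ℝ} (hyy' : y ≤ y') :
    armRate y' ≤ Real.sqrt (y' / y) * armRate y := by
  have hy' : 0 < y' := lt_of_lt_of_le hy hyy'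
  have h := log_armRate_exp_sub_le (Real.log_le_log hy hyy')
  rw [Real.exp_log hy, Real.exp_log hy'] at h
  have hβ := armRate_pos y
  have hβ' := armRate_pos y'
  rw [← Real.log_le_log_iff hβ' (by positivity), Real.log_mul (Real.sqrt_pos.2 (by positivity)).ne' hβ.ne',
    Real.log_sqrt (by positivity), Real.log_div hy'.ne' hy.ne']
  linarith

/-- **`β_rot(y)/√y` is non-increasing on `(0, ∞)`** (and tends to `1` by `tendsto_armRate_div_sqrt`).
[cite: Beaton2014RotatedHoneycomb, §3.1, Proposition 7 (arXiv v3 p. 11)] -/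
theorem antitoneOn_armRate_div_sqrt : AntitoneOn (fun y : ℝ => armRate y / Real.sqrt y) (Set.Ioi 0) := by
  intro y hy y' _ hyy'
  have hy0 : (0:ℝ) < y := hy
  have hy' : 0 < y' := lt_of_lt_of_le hy0 hyy'
  have h := armRate_le_sqrt_div_mul hy0 hyy'
  have hsy' : 0 < Real.sqrt y' := Real.sqrt_pos.2 hy'
  rw [Real.sqrt_div hy'.le] at h
  show armRate y' / Real.sqrt y' ≤ armRate y / Real.sqrt y
  rw [div_le_iff₀ hsy']
  calc armRate y' ≤ Real.sqrt y' / Real.sqrt y * armRate y := h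
    _ = armRate y / Real.sqrt y * Real.sqrt y' := by ring

/-- **Two-sided form**: `0 ≤ log β_rot(y') − log β_rot(y) ≤ (log y' − log y)/2` for `0 < y ≤ y'` (`log β_rot` is `½`-Lipschitz in `log y`).
[cite: Beaton2014RotatedHoneycomb, §3.1, Proposition 7 (arXiv v3 p. 11: "non-decreasing" and "log-convex")] -/
theorem log_armRate_sub_log_armRate_mem_Icc (hy : 0 < y) {y' : ℝ} (hyy' : y ≤ y') :
    Real.log (armRate y') - Real.log (armRate y) ∈ Set.Icc 0 ((Real.log y' - Real.log y) / 2) := by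
  have hy' : 0 < y' := lt_of_lt_of_le hy hyy'
  constructor
  · exact sub_nonneg.2 (Real.log_le_log (armRate_pos y) (armRate_mono hy hyy'))
  · have h := log_armRate_exp_sub_le (Real.log_le_log hy hyy')
    rwa [Real.exp_log hy, Real.exp_log hy'] at h

/-! ### Continuity and a.e. differentiability of `β_rot` -/

/-- **`β_rot` is continuous on `(0, ∞)`**: for `0 < y ≤ y'`, `β_rot(y) ≤ β_rot(y') ≤ √(y'/y) β_rot(y)`.
[cite: Beaton2014RotatedHoneycomb, §3.1, Proposition 7 (arXiv v3 p. 11: "and therefore continuous"); HammersleyTorrieWhittington1982, §2] -/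
theorem continuousOn_armRate : ContinuousOn armRate (Set.Ioi 0) := by
  -- `log ∘ β_rot ∘ exp` is `½`-Lipschitz (a fortiori `1`-Lipschitz), hence continuous; `β_rot = exp ∘ (log ∘ β_rot ∘ exp) ∘ log` on `(0, ∞)`
  have hlip : LipschitzWith 1 (fun t : ℝ => Real.log (armRate (Real.exp t))) := by
    refine LipschitzWith.of_dist_le_mul fun t₁ t₂ => ?_
    rw [Real.dist_eq, Real.dist_eq, NNReal.coe_one, one_mul]
    rcases le_total t₁ t₂ with h | h
    · have h1 := log_armRate_exp_sub_le h
      have h0 : 0 ≤ Real.log (armRate (Real.exp t₂)) - Real.log (armRate (Real.exp t₁)) :=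
        sub_nonneg.2 (Real.log_le_log (armRate_pos _) (armRate_mono (Real.exp_pos t₁) (Real.exp_le_exp.2 h)))
      rw [abs_sub_comm, abs_of_nonneg h0, abs_sub_comm, abs_of_nonneg (sub_nonneg.2 h)]
      linarith
    · have h1 := log_armRate_exp_sub_le h
      have h0 : 0 ≤ Real.log (armRate (Real.exp t₁)) - Real.log (armRate (Real.exp t₂)) :=
        sub_nonneg.2 (Real.log_le_log (armRate_pos _) (armRate_mono (Real.exp_pos t₂) (Real.exp_le_exp.2 h)))
      rw [abs_of_nonneg h0, abs_of_nonneg (sub_nonneg.2 h)]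
      linarith
  have hcont : Continuous fun t : ℝ => Real.exp (Real.log (armRate (Real.exp t))) := Real.continuous_exp.comp hlip.continuous
  have key : ContinuousOn (fun y : ℝ => Real.exp (Real.log (armRate (Real.exp (Real.log y))))) (Set.Ioi 0) :=
    hcont.comp_continuousOn (Real.continuousOn_log.mono fun y hy => ne_of_gt hy)
  refine key.congr fun y hy => ?_
  have hy0 : (0 : ℝ) < y := hy
  simp only [Real.exp_log hy0, Real.exp_log (armRate_pos y)]

/-- **`β_rot` is almost everywhere differentiable on `(0, ∞)`** (Lebesgue's theorem for monotone functions).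
[cite: Beaton2014RotatedHoneycomb, §3.1, Proposition 7 (arXiv v3 p. 11: "and therefore continuous and almost everywhere differentiable")] -/
theorem ae_differentiableAt_armRate : ∀ᵐ y : ℝ, 0 < y → DifferentiableAt ℝ armRate y :=
  (monotoneOn_armRate.ae_differentiableWithinAt_of_mem).mono fun _ h hy => (h hy).differentiableAt (Ioi_mem_nhds hy)

end Literature.Probability.RandomPlanarGeometry.SAW.HexBW.Arm

/-! ### The chord bound for Beaton's `μ(y) = max(β_rot(y), μ)` -/

namespace Literature.Probability.RandomPlanarGeometry.SAW.HV

open HexBW.Arm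

variable {y : ℝ}

/-- **`μ(y') ≤ √(y'/y) · μ(y)` for `0 < y ≤ y'`**, for Beaton's rotated half-plane rate in the dictionary form `rotSurfaceMu y = max (armRate y) μ`.
[cite: Beaton2014RotatedHoneycomb, §3.1, Proposition 7 (arXiv v3 p. 11: "a log-convex, non-decreasing function of log y"); HammersleyTorrieWhittington1982, §2] -/
theorem rotSurfaceMu_le_sqrt_div_mul (hy : 0 < y) {y' : ℝ} (hyy' : y ≤ y') :
    rotSurfaceMu y' ≤ Real.sqrt (y' / y) * rotSurfaceMu y := by
  have hq : 1 ≤ Real.sqrt (y' / y) := by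
    rw [← Real.sqrt_one]
    exact Real.sqrt_le_sqrt ((one_le_div hy).2 hyy')
  have hμ : 0 ≤ hexConnectiveConstant := hexConnectiveConstant_pos.le
  unfold rotSurfaceMu
  refine max_le ?_ ?_
  · exact (armRate_le_sqrt_div_mul hy hyy').trans (mul_le_mul_of_nonneg_left (le_max_left _ _) (zero_le_one.trans hq))
  · calc hexConnectiveConstant = 1 * hexConnectiveConstant := (one_mul _).symm
      _ ≤ Real.sqrt (y' / y) * max (armRate y) hexConnectiveConstant := mul_le_mul hq (le_max_right _ _) hμ (zero_le_one.trans hq)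

/-- **`μ(y)/√y` is non-increasing on `(0, ∞)`** (dictionary form). [cite: Beaton2014RotatedHoneycomb, §3.1, Proposition 7 (arXiv v3 p. 11)] -/
theorem antitoneOn_rotSurfaceMu_div_sqrt : AntitoneOn (fun y : ℝ => rotSurfaceMu y / Real.sqrt y) (Set.Ioi 0) := by
  intro y hy y' _ hyy'
  have hy0 : (0:ℝ) < y := hy
  have hy' : 0 < y' := lt_of_lt_of_le hy0 hyy'
  have h := rotSurfaceMu_le_sqrt_div_mul hy0 hyy'
  have hsy' : 0 < Real.sqrt y' := Real.sqrt_pos.2 hy'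
  rw [Real.sqrt_div hy'.le] at h
  show rotSurfaceMu y' / Real.sqrt y' ≤ rotSurfaceMu y / Real.sqrt y
  rw [div_le_iff₀ hsy']
  calc rotSurfaceMu y' ≤ Real.sqrt y' / Real.sqrt y * rotSurfaceMu y := h
    _ = rotSurfaceMu y / Real.sqrt y * Real.sqrt y' := by ring

/-! ### EDITION 3 — Proposition 7, clauses 2–4, for `μ(y) = max(β_rot(y), μ)`, door-free -/

/-- **`μ(y₁^θ y₂^{1−θ}) ≤ μ(y₁)^θ μ(y₂)^{1−θ}`** (`0 ≤ θ ≤ 1`) for `μ(y) = max(β_rot(y), μ)`: the maximum of two log-convex functions.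
[cite: Beaton2014RotatedHoneycomb, §3.1, Proposition 7 (arXiv v3 p. 11: "a log-convex … function of log y"); HammersleyTorrieWhittington1982, §2] -/
theorem rotSurfaceMu_rpow_mul_rpow_le {y₁ y₂ θ : ℝ} (hy₁ : 0 < y₁) (hy₂ : 0 < y₂) (hθ0 : 0 ≤ θ) (hθ1 : θ ≤ 1) :
    rotSurfaceMu (y₁ ^ θ * y₂ ^ (1 - θ)) ≤ rotSurfaceMu y₁ ^ θ * rotSurfaceMu y₂ ^ (1 - θ) := by
  rcases hθ0.eq_or_lt with rfl | hθ0'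
  · simp
  rcases hθ1.eq_or_lt with rfl | hθ1'
  · simp
  have hμ := hexConnectiveConstant_pos
  have hM₁ : 0 < rotSurfaceMu y₁ := rotSurfaceMu_pos y₁
  have hM₂ : 0 < rotSurfaceMu y₂ := rotSurfaceMu_pos y₂
  have hR : 0 ≤ rotSurfaceMu y₁ ^ θ * rotSurfaceMu y₂ ^ (1 - θ) := mul_nonneg (Real.rpow_nonneg hM₁.le _) (Real.rpow_nonneg hM₂.le _)
  have hβ : armRate (y₁ ^ θ * y₂ ^ (1 - θ)) ≤ rotSurfaceMu y₁ ^ θ * rotSurfaceMu y₂ ^ (1 - θ) :=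
    calc armRate (y₁ ^ θ * y₂ ^ (1 - θ)) ≤ armRate y₁ ^ θ * armRate y₂ ^ (1 - θ) := armRate_rpow_mul_rpow_le hy₁ hy₂ hθ0' hθ1'
      _ ≤ rotSurfaceMu y₁ ^ θ * rotSurfaceMu y₂ ^ (1 - θ) :=
        mul_le_mul (Real.rpow_le_rpow (armRate_pos _).le (armRate_le_rotSurfaceMu _) hθ0)
          (Real.rpow_le_rpow (armRate_pos _).le (armRate_le_rotSurfaceMu _) (sub_nonneg.2 hθ1))
          (Real.rpow_nonneg (armRate_pos _).le _) (Real.rpow_nonneg hM₁.le _)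
  have hc : hexConnectiveConstant ≤ rotSurfaceMu y₁ ^ θ * rotSurfaceMu y₂ ^ (1 - θ) :=
    calc hexConnectiveConstant = hexConnectiveConstant ^ θ * hexConnectiveConstant ^ (1 - θ) := by
          rw [← Real.rpow_add hμ, add_sub_cancel, Real.rpow_one]
      _ ≤ rotSurfaceMu y₁ ^ θ * rotSurfaceMu y₂ ^ (1 - θ) :=
        mul_le_mul (Real.rpow_le_rpow hμ.le (hexConnectiveConstant_le_rotSurfaceMu _) hθ0)
          (Real.rpow_le_rpow hμ.le (hexConnectiveConstant_le_rotSurfaceMu _) (sub_nonneg.2 hθ1))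
          (Real.rpow_nonneg hμ.le _) (Real.rpow_nonneg hM₁.le _)
  exact max_le hβ hc

/-- **Proposition 7, "log-convex … function of `log y`": `t ↦ log μ(eᵗ)` is convex on `ℝ`** for `μ(y) = max(β_rot(y), μ)` — door-free.
[cite: Beaton2014RotatedHoneycomb, §3.1, Proposition 7 (arXiv v3 p. 11: "It is a log-convex, non-decreasing function of log y"); HammersleyTorrieWhittington1982, §2] -/
theorem convexOn_log_rotSurfaceMu_exp : ConvexOn ℝ Set.univ (fun t : ℝ => Real.log (rotSurfaceMu (Real.exp t))) := by
  refine convexOn_iff_forall_pos.2 ⟨convex_univ, fun t₁ _ t₂ _ a b ha hb hab => ?_⟩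
  obtain rfl : b = 1 - a := by linarith
  simp only [smul_eq_mul]
  have h1 := Real.exp_pos t₁
  have h2 := Real.exp_pos t₂
  have key := rotSurfaceMu_rpow_mul_rpow_le h1 h2 ha.le (by linarith)
  have hexp : Real.exp (a * t₁ + (1 - a) * t₂) = Real.exp t₁ ^ a * Real.exp t₂ ^ (1 - a) := by
    rw [Real.exp_add, mul_comm a, mul_comm (1 - a), Real.exp_mul, Real.exp_mul]
  rw [hexp]
  calc Real.log (rotSurfaceMu (Real.exp t₁ ^ a * Real.exp t₂ ^ (1 - a)))
      ≤ Real.log (rotSurfaceMu (Real.exp t₁) ^ a * rotSurfaceMu (Real.exp t₂) ^ (1 - a)) := Real.log_le_log (rotSurfaceMu_pos _) key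
    _ = a * Real.log (rotSurfaceMu (Real.exp t₁)) + (1 - a) * Real.log (rotSurfaceMu (Real.exp t₂)) := by
        rw [Real.log_mul (Real.rpow_pos_of_pos (rotSurfaceMu_pos _) _).ne' (Real.rpow_pos_of_pos (rotSurfaceMu_pos _) _).ne',
          Real.log_rpow (rotSurfaceMu_pos _), Real.log_rpow (rotSurfaceMu_pos _)]

/-- **Proposition 7, "non-decreasing": `μ(y) = max(β_rot(y), μ)` is monotone on `(0, ∞)`** — door-free.
[cite: Beaton2014RotatedHoneycomb, §3.1, Proposition 7 (arXiv v3 p. 11: "non-decreasing")] -/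
theorem monotoneOn_rotSurfaceMu : MonotoneOn rotSurfaceMu (Set.Ioi 0) :=
  fun _ hy _ _ hyy' => max_le_max (armRate_mono hy hyy') le_rfl

/-- **Proposition 7, "therefore continuous": `μ(y)` is continuous on `(0, ∞)`** — door-free (`max` of two continuous functions).
[cite: Beaton2014RotatedHoneycomb, §3.1, Proposition 7 (arXiv v3 p. 11: "and therefore continuous"); HammersleyTorrieWhittington1982, §2] -/
theorem continuousOn_rotSurfaceMu : ContinuousOn rotSurfaceMu (Set.Ioi 0) := fun y hy =>
  show Tendsto (fun b : ℝ => max (armRate b) hexConnectiveConstant) (𝓝[Set.Ioi 0] y) (𝓝 (max (armRate y) hexConnectiveConstant)) from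
    (continuousOn_armRate y hy).max tendsto_const_nhds

/-- **Proposition 7, "almost everywhere differentiable": `μ(y)` is a.e. differentiable on `(0, ∞)`** (Lebesgue, from monotonicity) — door-free.
[cite: Beaton2014RotatedHoneycomb, §3.1, Proposition 7 (arXiv v3 p. 11: "and therefore continuous and almost everywhere differentiable")] -/
theorem ae_differentiableAt_rotSurfaceMu : ∀ᵐ y : ℝ, 0 < y → DifferentiableAt ℝ rotSurfaceMu y :=
  (monotoneOn_rotSurfaceMu.ae_differentiableWithinAt_of_mem).mono fun _ h hy => (h hy).differentiableAt (Ioi_mem_nhds hy)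

/-! ### EDITION 4 — the surface density window `[0, ½]` (where the derivative exists) -/

/-- A function of `t` all of whose increments over `[t, t']` lie in `[0, (t' − t)/2]` has every derivative in `[0, ½]`. [folklore] -/
private theorem deriv_mem_Icc_of_increments {φ : ℝ → ℝ} {t₀ φ' : ℝ} (hφ : HasDerivAt φ φ' t₀)
    (h : ∀ t t' : ℝ, t ≤ t' → φ t' - φ t ∈ Set.Icc 0 ((t' - t) / 2)) : φ' ∈ Set.Icc (0 : ℝ) (1 / 2) := by
  have ht : Tendsto (slope φ t₀) (𝓝[≠] t₀) (𝓝 φ') := hasDerivAt_iff_tendsto_slope.1 hφ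
  refine isClosed_Icc.mem_of_tendsto ht (eventually_nhdsWithin_of_forall fun t (ht0 : t ≠ t₀) => ?_)
  rw [slope_def_field]
  rcases lt_or_gt_of_ne ht0 with hlt | hgt
  · obtain ⟨h0, h1⟩ := h t t₀ hlt.le
    have hneg : t - t₀ < 0 := sub_neg.2 hlt
    constructor
    · exact div_nonneg_of_nonpos (by linarith) hneg.le
    · rw [div_le_iff_of_neg hneg]; linarith
  · obtain ⟨h0, h1⟩ := h t₀ t hgt.le
    have hpos : 0 < t - t₀ := sub_pos.2 hgt
    exact ⟨div_nonneg h0 hpos.le, (div_le_iff₀ hpos).2 (by linarith)⟩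

/-- Two-sided log form for `μ(y) = max(β_rot(y), μ)`: `0 ≤ log μ(y') − log μ(y) ≤ (log y' − log y)/2` for `0 < y ≤ y'`.
[cite: Beaton2014RotatedHoneycomb, §3.1, Proposition 7 (arXiv v3 p. 11: "log-convex, non-decreasing")] -/
theorem log_rotSurfaceMu_sub_mem_Icc (hy : 0 < y) {y' : ℝ} (hyy' : y ≤ y') :
    Real.log (rotSurfaceMu y') - Real.log (rotSurfaceMu y) ∈ Set.Icc 0 ((Real.log y' - Real.log y) / 2) := by
  have hy' : 0 < y' := hy.trans_le hyy'
  have hm := rotSurfaceMu_pos y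
  have hm' := rotSurfaceMu_pos y'
  refine ⟨sub_nonneg.2 (Real.log_le_log hm (monotoneOn_rotSurfaceMu hy hy' hyy')), ?_⟩
  have h := Real.log_le_log hm' (rotSurfaceMu_le_sqrt_div_mul hy hyy')
  rw [Real.log_mul (Real.sqrt_pos.2 (div_pos hy' hy)).ne' hm.ne', Real.log_sqrt (div_pos hy' hy).le,
    Real.log_div hy'.ne' hy.ne'] at h
  linarith

end Literature.Probability.RandomPlanarGeometry.SAW.HV

namespace Literature.Probability.RandomPlanarGeometry.SAW.HexBW.Arm

open HV

variable {y : ℝ}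

/-- **The armchair surface density lies in `[0, ½]`**: wherever `β_rot` is differentiable (a.e.), `y β_rot'(y)/β_rot(y) ∈ [0, ½]` — in the
free-energy sense at most every other vertex of a wall bridge lies on the wall.
[cite: Beaton2014RotatedHoneycomb, §3.1, Proposition 7 (arXiv v3 p. 11: "log-convex, non-decreasing … almost everywhere differentiable")] -/
theorem mul_deriv_div_armRate_mem_Icc (hy : 0 < y) (hd : DifferentiableAt ℝ armRate y) :
    y * deriv armRate y / armRate y ∈ Set.Icc (0 : ℝ) (1 / 2) := by
  have hd' : HasDerivAt armRate (deriv armRate y) (Real.exp (Real.log y)) := by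
    rw [Real.exp_log hy]; exact hd.hasDerivAt
  have hG : HasDerivAt (fun t : ℝ => Real.log (armRate (Real.exp t)))
      (deriv armRate y * Real.exp (Real.log y) / armRate (Real.exp (Real.log y))) (Real.log y) :=
    (hd'.comp (Real.log y) (Real.hasDerivAt_exp _)).log (armRate_pos _).ne'
  rw [Real.exp_log hy] at hG
  have key := deriv_mem_Icc_of_increments hG fun t t' htt' => by
    have h := log_armRate_sub_log_armRate_mem_Icc (Real.exp_pos t) (Real.exp_le_exp.2 htt')
    rwa [Real.log_exp, Real.log_exp] at h
  rwa [mul_comm (deriv armRate y) y] at key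

end Literature.Probability.RandomPlanarGeometry.SAW.HexBW.Arm

namespace Literature.Probability.RandomPlanarGeometry.SAW.HV

open HexBW.Arm

variable {y : ℝ}

/-- **The surface density of Beaton's rotated model lies in `[0, ½]` wherever `μ(y)` is differentiable** (a.e.).
[cite: Beaton2014RotatedHoneycomb, §1 (arXiv v3 p. 2: desorbed / adsorbed phases), §3.1, Proposition 7 (p. 11)] -/
theorem mul_deriv_div_rotSurfaceMu_mem_Icc (hy : 0 < y) (hd : DifferentiableAt ℝ rotSurfaceMu y) :
    y * deriv rotSurfaceMu y / rotSurfaceMu y ∈ Set.Icc (0 : ℝ) (1 / 2) := by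
  have hd' : HasDerivAt rotSurfaceMu (deriv rotSurfaceMu y) (Real.exp (Real.log y)) := by
    rw [Real.exp_log hy]; exact hd.hasDerivAt
  have hG : HasDerivAt (fun t : ℝ => Real.log (rotSurfaceMu (Real.exp t)))
      (deriv rotSurfaceMu y * Real.exp (Real.log y) / rotSurfaceMu (Real.exp (Real.log y))) (Real.log y) :=
    (hd'.comp (Real.log y) (Real.hasDerivAt_exp _)).log (rotSurfaceMu_pos _).ne'
  rw [Real.exp_log hy] at hG
  have key := deriv_mem_Icc_of_increments hG fun t t' htt' => by
    have h := log_rotSurfaceMu_sub_mem_Icc (Real.exp_pos t) (Real.exp_le_exp.2 htt')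
    rwa [Real.log_exp, Real.log_exp] at h
  rwa [mul_comm (deriv rotSurfaceMu y) y] at key

end Literature.Probability.RandomPlanarGeometry.SAW.HV

namespace Literature.Probability.RandomPlanarGeometry.SAW.HexBW.Arm

open HV

/-! ### EDITION 6 — one-sided densities exist at EVERY fugacity: left/right derivatives of `t ↦ log μ(eᵗ)`, both in `[0, ½]` -/

/-- A convex function on `ℝ` has a RIGHT derivative at every point (the infimum of the right secant slopes). [folklore] -/
private theorem convex_hasDerivWithinAt_Ioi {φ : ℝ → ℝ} (hφ : ConvexOn ℝ Set.univ φ) (t : ℝ) :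
    HasDerivWithinAt φ (sInf (slope φ t '' Set.Ioi t)) (Set.Ioi t) t := by
  rw [hasDerivWithinAt_iff_tendsto_slope' (show t ∉ Set.Ioi t from lt_irrefl t)]
  have hmono : MonotoneOn (slope φ t) (Set.Ioi t) := by
    intro u hu v hv huv
    rw [slope_def_field, slope_def_field]
    exact hφ.secant_mono (Set.mem_univ t) (Set.mem_univ u) (Set.mem_univ v) (ne_of_gt hu) (ne_of_gt hv) huv
  have hbdd : BddBelow (slope φ t '' Set.Ioi t) := by
    refine ⟨slope φ t (t - 1), ?_⟩
    rintro _ ⟨u, hu, rfl⟩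
    have hu' : t < u := hu
    rw [slope_def_field, slope_def_field]
    exact hφ.secant_mono (Set.mem_univ t) (Set.mem_univ _) (Set.mem_univ u) (by linarith) (ne_of_gt hu') (by linarith)
  exact hmono.tendsto_nhdsGT hbdd

/-- A convex function on `ℝ` has a LEFT derivative at every point (the supremum of the left secant slopes). [folklore] -/
private theorem convex_hasDerivWithinAt_Iio {φ : ℝ → ℝ} (hφ : ConvexOn ℝ Set.univ φ) (t : ℝ) :
    HasDerivWithinAt φ (sSup (slope φ t '' Set.Iio t)) (Set.Iio t) t := by
  rw [hasDerivWithinAt_iff_tendsto_slope' (show t ∉ Set.Iio t from lt_irrefl t)]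
  have hmono : MonotoneOn (slope φ t) (Set.Iio t) := by
    intro u hu v hv huv
    rw [slope_def_field, slope_def_field]
    exact hφ.secant_mono (Set.mem_univ t) (Set.mem_univ u) (Set.mem_univ v) (ne_of_lt hu) (ne_of_lt hv) huv
  have hbdd : BddAbove (slope φ t '' Set.Iio t) := by
    refine ⟨slope φ t (t + 1), ?_⟩
    rintro _ ⟨u, hu, rfl⟩
    have hu' : u < t := hu
    rw [slope_def_field, slope_def_field]
    exact hφ.secant_mono (Set.mem_univ t) (Set.mem_univ u) (Set.mem_univ _) (ne_of_lt hu') (by linarith) (by linarith)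
  exact hmono.tendsto_nhdsLT hbdd

/-- One-sided version of `deriv_mem_Icc_of_increments`: a one-sided derivative of a function whose increments over `[t, t']` lie in
`[0, (t' − t)/2]` lies in `[0, ½]`. [folklore] -/
private theorem derivWithin_mem_Icc_of_increments {φ : ℝ → ℝ} {t₀ φ' : ℝ} (right : Bool)
    (hφ : HasDerivWithinAt φ φ' (if right then Set.Ioi t₀ else Set.Iio t₀) t₀)
    (h : ∀ t t' : ℝ, t ≤ t' → φ t' - φ t ∈ Set.Icc 0 ((t' - t) / 2)) : φ' ∈ Set.Icc (0 : ℝ) (1 / 2) := by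
  have hnot : t₀ ∉ (if right then Set.Ioi t₀ else Set.Iio t₀) := by cases right <;> exact lt_irrefl t₀
  have ht : Tendsto (slope φ t₀) (𝓝[if right then Set.Ioi t₀ else Set.Iio t₀] t₀) (𝓝 φ') :=
    (hasDerivWithinAt_iff_tendsto_slope' hnot).1 hφ
  haveI : (𝓝[if right then Set.Ioi t₀ else Set.Iio t₀] t₀).NeBot := by
    cases right
    · exact nhdsLT_neBot t₀
    · exact nhdsGT_neBot t₀
  refine isClosed_Icc.mem_of_tendsto ht (eventually_nhdsWithin_of_forall fun t ht0 => ?_)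
  have hne : t ≠ t₀ := by
    cases right
    · exact ne_of_lt (by simpa using ht0)
    · exact ne_of_gt (by simpa using ht0)
  rw [slope_def_field]
  rcases lt_or_gt_of_ne hne with hlt | hgt
  · obtain ⟨h0, h1⟩ := h t t₀ hlt.le
    have hneg : t - t₀ < 0 := sub_neg.2 hlt
    constructor
    · exact div_nonneg_of_nonpos (by linarith) hneg.le
    · rw [div_le_iff_of_neg hneg]; linarith
  · obtain ⟨h0, h1⟩ := h t₀ t hgt.le
    have hpos : 0 < t - t₀ := sub_pos.2 hgt
    exact ⟨div_nonneg h0 hpos.le, (div_le_iff₀ hpos).2 (by linarith)⟩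

/-- **At EVERY `t`, the free energy `t ↦ log β_rot(eᵗ)` has a right derivative `ρ⁺ ∈ [0, ½]` and a left derivative `ρ⁻ ∈ [0, ½]` with
`ρ⁻ ≤ ρ⁺`** — the one-sided densities of adsorbed vertices exist at every fugacity (convexity), in particular at the transition.
[cite: Beaton2014RotatedHoneycomb, §3.1, Proposition 7 (arXiv v3 p. 11: "log-convex, non-decreasing … almost everywhere differentiable"); HammersleyTorrieWhittington1982, §2] -/
theorem exists_one_sided_deriv_log_armRate_exp (t : ℝ) :
    ∃ ρm ρp : ℝ, HasDerivWithinAt (fun s : ℝ => Real.log (armRate (Real.exp s))) ρm (Set.Iio t) t ∧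
      HasDerivWithinAt (fun s : ℝ => Real.log (armRate (Real.exp s))) ρp (Set.Ioi t) t ∧
      0 ≤ ρm ∧ ρm ≤ ρp ∧ ρp ≤ 1 / 2 := by
  set φ : ℝ → ℝ := fun s => Real.log (armRate (Real.exp s)) with hφ
  have hconv : ConvexOn ℝ Set.univ φ := convexOn_log_armRate_exp
  have hincr : ∀ u u' : ℝ, u ≤ u' → φ u' - φ u ∈ Set.Icc 0 ((u' - u) / 2) := fun u u' huu' => by
    have h := log_armRate_sub_log_armRate_mem_Icc (Real.exp_pos u) (Real.exp_le_exp.2 huu')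
    rwa [Real.log_exp, Real.log_exp] at h
  have hR := convex_hasDerivWithinAt_Ioi hconv t
  have hL := convex_hasDerivWithinAt_Iio hconv t
  refine ⟨_, _, hL, hR, (derivWithin_mem_Icc_of_increments false (by simpa using hL) hincr).1, ?_,
    (derivWithin_mem_Icc_of_increments true (by simpa using hR) hincr).2⟩
  -- `ρ⁻ ≤ ρ⁺`: every left secant slope is `≤` every right secant slope
  have hne : (slope φ t '' Set.Iio t).Nonempty := ⟨_, t - 1, by simp, rfl⟩
  have hne' : (slope φ t '' Set.Ioi t).Nonempty := ⟨_, t + 1, by simp, rfl⟩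
  refine csSup_le hne ?_
  rintro _ ⟨u, hu, rfl⟩
  refine le_csInf hne' ?_
  rintro _ ⟨v, hv, rfl⟩
  have hu' : u < t := hu
  have hv' : t < v := hv
  rw [slope_def_field, slope_def_field]
  exact hconv.secant_mono (Set.mem_univ t) (Set.mem_univ u) (Set.mem_univ v) (ne_of_lt hu') (ne_of_gt hv') (by linarith)

end Literature.Probability.RandomPlanarGeometry.SAW.HexBW.Arm

namespace Literature.Probability.RandomPlanarGeometry.SAW.HexBW.Arm

open HV

variable {y : ℝ}

/-! ### EDITION 7 — the one-sided SURFACE DENSITIES `ρ⁻(t) ≤ ρ⁺(t)` of the armchair free energy `κ_rot(t) = log β_rot(eᵗ)` as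
functions of `t = log y`: window `[0, ½]`, monotone and interlacing (convexity), the density identity at points of
differentiability, and SATURATION — `ρ±(t) → ½` as `t → ∞` with the explicit deficit `½ − 109e·e^{−t/2} ≤ ρ⁻(t)` for
`t ≥ 2 + 2 log 218`: at large fugacity one vertex in two of a long armchair wall bridge lies on the wall, the most the
armchair boundary allows -/

/-- **`κ_rot(t) := log β_rot(eᵗ)`**, the armchair wall-bridge free energy as a function of `t = log y` — a convex function
(`convexOn_log_armRate_exp`) whose one-sided derivatives are the densities of adsorbed vertices.
[cite: Beaton2014RotatedHoneycomb, §3.1, Proposition 7 (arXiv v3 p. 11: "log-convex, non-decreasing function of log y"); HammersleyTorrieWhittington1982, §2] -/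
def armFreeEnergy (t : ℝ) : ℝ := Real.log (armRate (Real.exp t))

/-- **`ρ⁺(t) := d⁺κ_rot/dt (t)`**, the RIGHT density of adsorbed vertices of armchair wall bridges at fugacity `y = eᵗ` (the right
derivative of the convex free energy; it exists at every `t`, `hasDerivWithinAt_armRightDensity`). The hypercubic analogue is
the right-density `𝓔_+(a) = a d⁺κ/da` of Janse van Rensburg–Whittington.
[cite: Beaton2014RotatedHoneycomb, §3.1, Proposition 7 (arXiv v3 p. 11: "almost everywhere differentiable"); JansevanRensburgWhittington2013, §3.1 eq. (3.4) (arXiv v4 p. 6: hypercubic analogue)] -/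
def armRightDensity (t : ℝ) : ℝ := derivWithin armFreeEnergy (Set.Ioi t) t

/-- **`ρ⁻(t) := d⁻κ_rot/dt (t)`**, the LEFT density of adsorbed vertices of armchair wall bridges at fugacity `y = eᵗ`.
[cite: Beaton2014RotatedHoneycomb, §3.1, Proposition 7 (arXiv v3 p. 11); JansevanRensburgWhittington2013, §3.1 eq. (3.4) (arXiv v4 p. 6: hypercubic analogue)] -/
def armLeftDensity (t : ℝ) : ℝ := derivWithin armFreeEnergy (Set.Iio t) t

/-- `κ_rot(t) = log β_rot(eᵗ)` (unfolding). [cite: Beaton2014RotatedHoneycomb, §3.1, Proposition 7 (arXiv v3 p. 11)] -/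
theorem armFreeEnergy_apply (t : ℝ) : armFreeEnergy t = Real.log (armRate (Real.exp t)) := rfl

/-- **`κ_rot` is convex on `ℝ`** (= `convexOn_log_armRate_exp`, Proposition 7's "log-convex … function of log y" for `β_rot`).
[cite: Beaton2014RotatedHoneycomb, §3.1, Proposition 7 (arXiv v3 p. 11); HammersleyTorrieWhittington1982, §2] -/
theorem convexOn_armFreeEnergy : ConvexOn ℝ Set.univ armFreeEnergy := convexOn_log_armRate_exp

/-- `0 ≤ κ_rot(t') − κ_rot(t) ≤ (t' − t)/2` for `t ≤ t'` (= `log_armRate_sub_log_armRate_mem_Icc` in the variable `t = log y`).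
[cite: Beaton2014RotatedHoneycomb, §3.1, Proposition 7 (arXiv v3 p. 11: "non-decreasing")] -/
theorem armFreeEnergy_sub_mem_Icc {t t' : ℝ} (htt' : t ≤ t') :
    armFreeEnergy t' - armFreeEnergy t ∈ Set.Icc (0 : ℝ) ((t' - t) / 2) := by
  have h := log_armRate_sub_log_armRate_mem_Icc (Real.exp_pos t) (Real.exp_le_exp.2 htt')
  rwa [Real.log_exp, Real.log_exp] at h

/-- Every chord of `κ_rot` has slope in `[0, ½]`. [cite: Beaton2014RotatedHoneycomb, §3.1, Proposition 7 (arXiv v3 p. 11)] -/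
theorem slope_armFreeEnergy_mem_Icc {t t' : ℝ} (h : t < t') : slope armFreeEnergy t t' ∈ Set.Icc (0 : ℝ) (1 / 2) := by
  obtain ⟨h0, h1⟩ := armFreeEnergy_sub_mem_Icc h.le
  have hpos : 0 < t' - t := sub_pos.2 h
  rw [slope_def_field]
  exact ⟨div_nonneg h0 hpos.le, (div_le_iff₀ hpos).2 (by linarith)⟩

/-- **`ρ⁺(t)` IS the right derivative of `κ_rot` at `t`** (it exists at every `t`, by convexity).
[cite: Beaton2014RotatedHoneycomb, §3.1, Proposition 7 (arXiv v3 p. 11); JansevanRensburgWhittington2013, §3.1 eq. (3.4) (arXiv v4 p. 6: «These exist for every finite a > 0 since κ(a) is a convex function of log a»)] -/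
theorem hasDerivWithinAt_armRightDensity (t : ℝ) :
    HasDerivWithinAt armFreeEnergy (armRightDensity t) (Set.Ioi t) t :=
  convexOn_armFreeEnergy.hasDerivWithinAt_rightDeriv_of_mem_interior (by simp)

/-- **`ρ⁻(t)` IS the left derivative of `κ_rot` at `t`.**
[cite: Beaton2014RotatedHoneycomb, §3.1, Proposition 7 (arXiv v3 p. 11); JansevanRensburgWhittington2013, §3.1 eq. (3.4) (arXiv v4 p. 6)] -/
theorem hasDerivWithinAt_armLeftDensity (t : ℝ) :
    HasDerivWithinAt armFreeEnergy (armLeftDensity t) (Set.Iio t) t :=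
  convexOn_armFreeEnergy.hasDerivWithinAt_leftDeriv_of_mem_interior (by simp)

/-- **`ρ⁻(t) ≤ ρ⁺(t)`** at every `t`. [cite: Beaton2014RotatedHoneycomb, §3.1, Proposition 7 (arXiv v3 p. 11); JansevanRensburgWhittington2013, §3.1 eq. (3.4) (arXiv v4 p. 6: «𝓔_-(a) ≤ 𝓔_+(a)»)] -/
theorem armLeftDensity_le_armRightDensity (t : ℝ) : armLeftDensity t ≤ armRightDensity t :=
  convexOn_armFreeEnergy.leftDeriv_le_rightDeriv_of_mem_interior (by simp)

/-- **`ρ⁺` is non-decreasing.** [cite: Beaton2014RotatedHoneycomb, §3.1, Proposition 7 (arXiv v3 p. 11: "log-convex"); JansevanRensburgWhittington2013, §3.1 (arXiv v4 p. 6: «monotone functions»)] -/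
theorem monotone_armRightDensity : Monotone armRightDensity := by
  intro t t' h
  have := convexOn_armFreeEnergy.monotoneOn_rightDeriv (by simp : t ∈ interior (Set.univ : Set ℝ)) (by simp) h
  simpa [armRightDensity] using this

/-- **`ρ⁻` is non-decreasing.** [cite: Beaton2014RotatedHoneycomb, §3.1, Proposition 7 (arXiv v3 p. 11: "log-convex"); JansevanRensburgWhittington2013, §3.1 (arXiv v4 p. 6)] -/
theorem monotone_armLeftDensity : Monotone armLeftDensity := by
  intro t t' h
  have := convexOn_armFreeEnergy.monotoneOn_leftDeriv (by simp : t ∈ interior (Set.univ : Set ℝ)) (by simp) h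
  simpa [armLeftDensity] using this

/-- `ρ⁺(t) ≤ (κ_rot(t') − κ_rot(t))/(t' − t)` for `t < t'`. [cite: Beaton2014RotatedHoneycomb, §3.1, Proposition 7 (arXiv v3 p. 11: "log-convex")] -/
theorem armRightDensity_le_slope {t t' : ℝ} (h : t < t') : armRightDensity t ≤ slope armFreeEnergy t t' :=
  convexOn_armFreeEnergy.rightDeriv_le_slope_of_mem_interior (by simp) (Set.mem_univ t') h

/-- `(κ_rot(t') − κ_rot(t))/(t' − t) ≤ ρ⁻(t')` for `t < t'`. [cite: Beaton2014RotatedHoneycomb, §3.1, Proposition 7 (arXiv v3 p. 11: "log-convex")] -/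
theorem slope_le_armLeftDensity {t t' : ℝ} (h : t < t') : slope armFreeEnergy t t' ≤ armLeftDensity t' :=
  convexOn_armFreeEnergy.slope_le_leftDeriv_of_mem_interior (Set.mem_univ t) (by simp) h

/-- **The one-sided densities interlace: `ρ⁺(t) ≤ ρ⁻(t')` for `t < t'`.** [cite: Beaton2014RotatedHoneycomb, §3.1, Proposition 7 (arXiv v3 p. 11: "log-convex")] -/
theorem armRightDensity_le_armLeftDensity_of_lt {t t' : ℝ} (h : t < t') : armRightDensity t ≤ armLeftDensity t' :=
  (armRightDensity_le_slope h).trans (slope_le_armLeftDensity h)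

/-- **`0 ≤ ρ⁻(t)`.** [cite: Beaton2014RotatedHoneycomb, §3.1, Proposition 7 (arXiv v3 p. 11: "non-decreasing")] -/
theorem armLeftDensity_nonneg (t : ℝ) : 0 ≤ armLeftDensity t :=
  (slope_armFreeEnergy_mem_Icc (sub_one_lt t)).1.trans (slope_le_armLeftDensity (sub_one_lt t))

/-- **`ρ⁺(t) ≤ ½`** — at most one vertex in two of an armchair wall bridge is a wall vertex, in density.
[cite: Beaton2014RotatedHoneycomb, §3.1, Proposition 7 (arXiv v3 p. 11: "μ(y) ≥ max{μ, √y}" — with the tree's matching order √y at infinity)] -/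
theorem armRightDensity_le_half (t : ℝ) : armRightDensity t ≤ 1 / 2 :=
  (armRightDensity_le_slope (lt_add_one t)).trans (slope_armFreeEnergy_mem_Icc (lt_add_one t)).2

/-- **`0 ≤ ρ⁻(t) ≤ ρ⁺(t) ≤ ½` at every `t`.** [cite: Beaton2014RotatedHoneycomb, §3.1, Proposition 7 (arXiv v3 p. 11)] -/
theorem armDensities_mem_Icc (t : ℝ) :
    0 ≤ armLeftDensity t ∧ armLeftDensity t ≤ armRightDensity t ∧ armRightDensity t ≤ 1 / 2 :=
  ⟨armLeftDensity_nonneg t, armLeftDensity_le_armRightDensity t, armRightDensity_le_half t⟩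

/-- **Density identity at points of differentiability: if `β_rot` is differentiable at `y = eᵗ` then
`ρ⁺(t) = y β_rot'(y)/β_rot(y)`** (the logarithmic derivative of `SQM`'s density window `mul_deriv_div_armRate_mem_Icc`).
[cite: Beaton2014RotatedHoneycomb, §3.1, Proposition 7 (arXiv v3 p. 11: "almost everywhere differentiable"); JansevanRensburgWhittington2013, §3.1 eq. (3.3) (arXiv v4 p. 6)] -/
theorem armRightDensity_eq_of_differentiableAt {t : ℝ} (hd : DifferentiableAt ℝ armRate (Real.exp t)) :
    armRightDensity t = Real.exp t * deriv armRate (Real.exp t) / armRate (Real.exp t) := by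
  have h1 : HasDerivAt (fun s : ℝ => armRate (Real.exp s)) (deriv armRate (Real.exp t) * Real.exp t) t :=
    hd.hasDerivAt.comp t (Real.hasDerivAt_exp t)
  have h2 : HasDerivAt armFreeEnergy ((deriv armRate (Real.exp t) * Real.exp t) / armRate (Real.exp t)) t := by
    have h := h1.log (armRate_pos _).ne'
    exact h
  rw [armRightDensity, (h2.hasDerivWithinAt (s := Set.Ioi t)).derivWithin (uniqueDiffWithinAt_Ioi t)]
  ring

/-- **… and `ρ⁻(t) = y β_rot'(y)/β_rot(y)` too** (so `ρ⁻(t) = ρ⁺(t)` wherever `β_rot` is differentiable, i.e. almost everywhere).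
[cite: Beaton2014RotatedHoneycomb, §3.1, Proposition 7 (arXiv v3 p. 11: "almost everywhere differentiable"); JansevanRensburgWhittington2013, §3.1 eq. (3.3) (arXiv v4 p. 6)] -/
theorem armLeftDensity_eq_of_differentiableAt {t : ℝ} (hd : DifferentiableAt ℝ armRate (Real.exp t)) :
    armLeftDensity t = Real.exp t * deriv armRate (Real.exp t) / armRate (Real.exp t) := by
  have h1 : HasDerivAt (fun s : ℝ => armRate (Real.exp s)) (deriv armRate (Real.exp t) * Real.exp t) t :=
    hd.hasDerivAt.comp t (Real.hasDerivAt_exp t)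
  have h2 : HasDerivAt armFreeEnergy ((deriv armRate (Real.exp t) * Real.exp t) / armRate (Real.exp t)) t := by
    have h := h1.log (armRate_pos _).ne'
    exact h
  rw [armLeftDensity, (h2.hasDerivWithinAt (s := Set.Iio t)).derivWithin (uniqueDiffWithinAt_Iio t)]
  ring

/-! #### Saturation: `κ_rot(t) − t/2 → 0` squeezes the densities to `½` -/

/-- **`κ_rot(t) − t/2 → 0` as `t → ∞`** (= `tendsto_log_armRate_sub_half_log` in the variable `t = log y`).
[cite: Beaton2014RotatedHoneycomb, §3.1, Proposition 7 (arXiv v3 p. 11: "μ(y) ≥ max{μ, √y}"); BeatonBousquetMelouDeGierDuminilCopinGuttmann2014, §3.1 (arXiv v5 p. 10: "This translates into μ(y) ∼ √y in our honeycomb setting")] -/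
theorem tendsto_armFreeEnergy_sub_half : Tendsto (fun t : ℝ => armFreeEnergy t - t / 2) atTop (𝓝 0) := by
  have h := tendsto_log_armRate_sub_half_log.comp Real.tendsto_exp_atTop
  refine h.congr fun t => ?_
  simp only [Function.comp_def, armFreeEnergy, Real.log_exp]

/-- **`t/2 ≤ κ_rot(t)`** at every `t` (`β_rot(y) ≥ √y`). [cite: Beaton2014RotatedHoneycomb, §3.1, Proposition 7 (arXiv v3 p. 11: "μ(y) ≥ max{μ, √y}")] -/
theorem half_le_armFreeEnergy (t : ℝ) : t / 2 ≤ armFreeEnergy t := by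
  have hs : 0 < Real.sqrt (Real.exp t) := Real.sqrt_pos.2 (Real.exp_pos t)
  have h1 := one_le_armRate_div_sqrt (Real.exp_pos t)
  rw [le_div_iff₀ hs, one_mul] at h1
  have h3 := Real.log_le_log hs h1
  rw [Real.log_sqrt (Real.exp_pos t).le, Real.log_exp] at h3
  exact h3

/-- **`κ_rot(t) − t/2 ≤ 218·e^{−t/2}` for `t ≥ 2 log 218`** — the tree's window `β_rot(y) ≤ √y/(1 − 109/√y)` (`y > 109²`) in
logarithmic form, with `−log(1 − x) ≤ 2x` for `0 ≤ x ≤ ½`. [cite: Beaton2014RotatedHoneycomb, §3.1, Proposition 7 (arXiv v3 p. 11)] -/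
theorem armFreeEnergy_sub_half_le {t : ℝ} (ht : 2 * Real.log 218 ≤ t) :
    armFreeEnergy t - t / 2 ≤ 218 * Real.exp (-(t / 2)) := by
  set s : ℝ := Real.exp (t / 2) with hs_def
  have hs0 : 0 < s := Real.exp_pos _
  have hs218 : 218 ≤ s := by
    have h : Real.log 218 ≤ t / 2 := by linarith
    have := Real.exp_le_exp.2 h
    rwa [Real.exp_log (by norm_num : (0 : ℝ) < 218)] at this
  have hy : Real.exp t = s ^ 2 := by rw [hs_def, sq, ← Real.exp_add]; ring_nf
  have hsqrt : Real.sqrt (Real.exp t) = s := by rw [hy, Real.sqrt_sq hs0.le]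
  have hy109 : (109 : ℝ) ^ 2 < Real.exp t := by rw [hy]; nlinarith
  -- the window, in the variable `s = √y`
  have hβ : armRate (Real.exp t) ≤ s / (1 - 109 / s) := by
    have h := armRate_le_sqrt_div hy109
    rwa [hsqrt] at h
  have hx1 : 109 / s ≤ 1 / 2 := by rw [div_le_iff₀ hs0]; linarith
  have hx0 : 0 < 109 / s := div_pos (by norm_num) hs0
  have h1x : 0 < 1 - 109 / s := by linarith
  have hq0 : 0 < s / (1 - 109 / s) := div_pos hs0 h1x
  -- `log β ≤ log s − log(1 − x)`
  have hlog : armFreeEnergy t ≤ Real.log s - Real.log (1 - 109 / s) := by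
    have h := Real.log_le_log (armRate_pos _) hβ
    rw [Real.log_div hs0.ne' h1x.ne'] at h
    exact h
  have hlogs : Real.log s = t / 2 := by rw [hs_def, Real.log_exp]
  -- `−log(1 − x) = log (1/(1−x)) ≤ 1/(1−x) − 1 = x/(1−x) ≤ 2x`
  have hneg : -Real.log (1 - 109 / s) ≤ 2 * (109 / s) := by
    have h := Real.log_le_sub_one_of_pos (inv_pos.2 h1x)
    rw [Real.log_inv] at h
    have h' : (1 - 109 / s)⁻¹ - 1 = (109 / s) / (1 - 109 / s) := by
      rw [eq_div_iff h1x.ne', sub_mul, inv_mul_cancel₀ h1x.ne', one_mul]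
      ring
    rw [h'] at h
    have h'' : (109 / s) / (1 - 109 / s) ≤ 2 * (109 / s) := by
      rw [div_le_iff₀ h1x]
      nlinarith
    linarith
  have hexp : Real.exp (-(t / 2)) = 1 / s := by rw [hs_def, Real.exp_neg, one_div]
  rw [hexp]
  have : 2 * (109 / s) = 218 * (1 / s) := by ring
  linarith

/-- **SATURATION WITH A RATE: `½ − 109e·e^{−t/2} ≤ ρ⁻(t)` for `t ≥ 2 + 2 log 218`** (in the fugacity: `½ − 109e/√y ≤ ρ⁻ ≤ ρ⁺ ≤ ½`
for `y ≥ (218e)²`) — the chord from `t − 2`, whose left end is within `218e·e^{−t/2}` of the line `t/2` that bounds `κ_rot` below.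
[cite: Beaton2014RotatedHoneycomb, §3.1, Proposition 7 (arXiv v3 p. 11: "μ(y) ≥ max{μ, √y}"); BeatonBousquetMelouDeGierDuminilCopinGuttmann2014, §3.1 (arXiv v5 p. 10: "μ(y) ∼ √y")] -/
theorem half_sub_le_armLeftDensity {t : ℝ} (ht : 2 + 2 * Real.log 218 ≤ t) :
    1 / 2 - 109 * Real.exp 1 * Real.exp (-(t / 2)) ≤ armLeftDensity t := by
  have hlt : t - 2 < t := by linarith
  refine le_trans ?_ (slope_le_armLeftDensity hlt)
  rw [slope_def_field]
  have h1 := half_le_armFreeEnergy t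
  have h2 := armFreeEnergy_sub_half_le (t := t - 2) (by linarith)
  have he : Real.exp (-((t - 2) / 2)) = Real.exp 1 * Real.exp (-(t / 2)) := by
    rw [← Real.exp_add]; ring_nf
  rw [he] at h2
  rw [show t - (t - 2) = (2 : ℝ) by ring, le_div_iff₀ (by norm_num : (0 : ℝ) < 2)]
  nlinarith [Real.exp_pos 1, Real.exp_pos (-(t / 2))]

/-- **`ρ⁻(t) → ½` as `t → ∞`**: at large surface fugacity the density of adsorbed vertices of armchair wall bridges saturates at
one half. [cite: Beaton2014RotatedHoneycomb, §3.1, Proposition 7 (arXiv v3 p. 11: "μ(y) ≥ max{μ, √y}"); BeatonBousquetMelouDeGierDuminilCopinGuttmann2014, §3.1 (arXiv v5 p. 10: "μ(y) ∼ √y"); JansevanRensburgWhittington2013, §3.1 Corollary 1 / Theorem 5 (arXiv v4 p. 9: κ(a) ∼ log μ_{d−1} + log a — hypercubic analogue; density → 1 by convexity)] -/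
theorem tendsto_armLeftDensity_atTop : Tendsto armLeftDensity atTop (𝓝 (1 / 2)) := by
  have hexp : Tendsto (fun t : ℝ => Real.exp (-(t / 2))) atTop (𝓝 0) := by
    have h := Real.tendsto_exp_neg_atTop_nhds_zero.comp (tendsto_id.atTop_div_const (by norm_num : (0 : ℝ) < 2))
    refine h.congr fun t => ?_
    simp only [Function.comp_def, id]
  have hlow : Tendsto (fun t : ℝ => 1 / 2 - 109 * Real.exp 1 * Real.exp (-(t / 2))) atTop (𝓝 (1 / 2)) := by
    have h := (hexp.const_mul (109 * Real.exp 1)).const_sub (1 / 2)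
    rwa [mul_zero, sub_zero] at h
  refine tendsto_of_tendsto_of_tendsto_of_le_of_le' hlow tendsto_const_nhds ?_ ?_
  · filter_upwards [eventually_ge_atTop (2 + 2 * Real.log 218)] with t ht using half_sub_le_armLeftDensity ht
  · exact Eventually.of_forall fun t => (armLeftDensity_le_armRightDensity t).trans (armRightDensity_le_half t)

/-- **`ρ⁺(t) → ½` as `t → ∞`.** [cite: Beaton2014RotatedHoneycomb, §3.1, Proposition 7 (arXiv v3 p. 11: "μ(y) ≥ max{μ, √y}"); BeatonBousquetMelouDeGierDuminilCopinGuttmann2014, §3.1 (arXiv v5 p. 10: "μ(y) ∼ √y")] -/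
theorem tendsto_armRightDensity_atTop : Tendsto armRightDensity atTop (𝓝 (1 / 2)) :=
  tendsto_of_tendsto_of_tendsto_of_le_of_le' tendsto_armLeftDensity_atTop tendsto_const_nhds
    (Eventually.of_forall armLeftDensity_le_armRightDensity) (Eventually.of_forall armRightDensity_le_half)

/-! #### Strictness: no chord of `κ_rot` has slope `½`, so `β_rot(y)/√y` is STRICTLY decreasing and the density never
reaches `½` at a finite fugacity -/

/-- **Every chord of `κ_rot` has slope `< ½` strictly.**  If the chord over `[t, t']` had slope `½`, the three-chord inequality
would force every chord over `[t', u]` to have slope `½` as well (`≥` by convexity, `≤` by the window), so `κ_rot(u) − u/2` would be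
constant on `[t', ∞)`, hence `0` (it tends to `0`), i.e. `β_rot(y') = √y'` — contradicting the strict bound `√y < β_rot(y)` of
`HexSAWArmchairSqrtStrict.lean`. [cite: Beaton2014RotatedHoneycomb, §3.1, Proposition 7 (arXiv v3 p. 11: "log-convex … μ(y) ≥ max{μ, √y}")] -/
theorem slope_armFreeEnergy_lt_half {t t' : ℝ} (h : t < t') : slope armFreeEnergy t t' < 1 / 2 := by
  refine lt_of_le_of_ne (slope_armFreeEnergy_mem_Icc h).2 fun heq => ?_
  -- every chord to the right of `t'` has slope exactly `½`
  have hright : ∀ u : ℝ, t' < u → armFreeEnergy u - u / 2 = armFreeEnergy t' - t' / 2 := by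
    intro u hu
    have h1 : slope armFreeEnergy t t' ≤ slope armFreeEnergy t' u := by
      rw [slope_def_field, slope_def_field]
      exact convexOn_armFreeEnergy.slope_mono_adjacent (Set.mem_univ t) (Set.mem_univ u) h hu
    have h2 := (slope_armFreeEnergy_mem_Icc hu).2
    have hs : slope armFreeEnergy t' u = 1 / 2 := le_antisymm h2 (heq ▸ h1)
    rw [slope_def_field, div_eq_iff (sub_pos.2 hu).ne'] at hs
    linarith
  -- so the constant value is the limit `0`
  have hconst : Tendsto (fun u : ℝ => armFreeEnergy u - u / 2) atTop (𝓝 (armFreeEnergy t' - t' / 2)) := by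
    refine tendsto_const_nhds.congr' ?_
    filter_upwards [eventually_gt_atTop t'] with u hu using (hright u hu).symm
  have h0 : armFreeEnergy t' - t' / 2 = 0 := tendsto_nhds_unique hconst tendsto_armFreeEnergy_sub_half
  -- contradiction with `√y < β_rot(y)` at `y = e^{t'}`
  have hs0 : 0 < Real.sqrt (Real.exp t') := Real.sqrt_pos.2 (Real.exp_pos t')
  have hlog := Real.log_lt_log hs0 (sqrt_lt_armRate (Real.exp_pos t'))
  rw [Real.log_sqrt (Real.exp_pos t').le, Real.log_exp] at hlog
  rw [armFreeEnergy_apply] at h0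
  linarith

/-- **`κ_rot(t') − κ_rot(t) < (t' − t)/2` for `t < t'`.** [cite: Beaton2014RotatedHoneycomb, §3.1, Proposition 7 (arXiv v3 p. 11)] -/
theorem armFreeEnergy_sub_lt {t t' : ℝ} (h : t < t') : armFreeEnergy t' - armFreeEnergy t < (t' - t) / 2 := by
  have hs := slope_armFreeEnergy_lt_half h
  rw [slope_def_field, div_lt_iff₀ (sub_pos.2 h)] at hs
  linarith

/-- **STRICT chord bound: `β_rot(y') < √(y'/y) · β_rot(y)` for `0 < y < y'`** — the strict form of `armRate_le_sqrt_div_mul`.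
[cite: Beaton2014RotatedHoneycomb, §3.1, Proposition 7 (arXiv v3 p. 11: "log-convex, non-decreasing function of log y … μ(y) ≥ max{μ, √y}")] -/
theorem armRate_lt_sqrt_div_mul (hy : 0 < y) {y' : ℝ} (hyy' : y < y') : armRate y' < Real.sqrt (y' / y) * armRate y := by
  have hy' : 0 < y' := hy.trans hyy'
  have h := armFreeEnergy_sub_lt (Real.log_lt_log hy hyy')
  rw [armFreeEnergy_apply, armFreeEnergy_apply, Real.exp_log hy, Real.exp_log hy'] at h
  have hβ := armRate_pos y
  have hβ' := armRate_pos y'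
  -- exponentiate: `β(y') < exp((log y' − log y)/2) · β(y) = √(y'/y) β(y)`
  have h1 : Real.log (armRate y') < (Real.log y' - Real.log y) / 2 + Real.log (armRate y) := by linarith
  have h2 := Real.exp_lt_exp.2 h1
  rw [Real.exp_log hβ', Real.exp_add, Real.exp_log hβ] at h2
  have h3 : Real.exp ((Real.log y' - Real.log y) / 2) = Real.sqrt (y' / y) := by
    rw [← Real.log_div hy'.ne' hy.ne', Real.sqrt_eq_rpow, Real.rpow_def_of_pos (div_pos hy' hy)]
    ring_nf
  rwa [h3] at h2

/-- **`β_rot(y)/√y` is STRICTLY decreasing on `(0, ∞)`** (and tends to `1`): the strict form of `antitoneOn_armRate_div_sqrt`.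
[cite: Beaton2014RotatedHoneycomb, §3.1, Proposition 7 (arXiv v3 p. 11: "μ(y) ≥ max{μ, √y}")] -/
theorem strictAntiOn_armRate_div_sqrt : StrictAntiOn (fun y : ℝ => armRate y / Real.sqrt y) (Set.Ioi 0) := by
  intro y hy y' hy' hyy'
  have hy0 : (0 : ℝ) < y := hy
  have hy0' : (0 : ℝ) < y' := hy'
  have h := armRate_lt_sqrt_div_mul hy0 hyy'
  have hs : 0 < Real.sqrt y := Real.sqrt_pos.2 hy0
  have hs' : 0 < Real.sqrt y' := Real.sqrt_pos.2 hy0'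
  show armRate y' / Real.sqrt y' < armRate y / Real.sqrt y
  rw [div_lt_div_iff₀ hs' hs]
  rw [Real.sqrt_div hy0'.le, div_mul_eq_mul_div, lt_div_iff₀ hs] at h
  linarith

/-- **No saturation at a finite fugacity: `ρ⁺(t) < ½` for EVERY `t`** (`ρ⁺(t) ≤` the slope of the chord over `[t, t+1]`, which is `< ½`).
[cite: Beaton2014RotatedHoneycomb, §3.1, Proposition 7 (arXiv v3 p. 11: "log-convex … μ(y) ≥ max{μ, √y}")] -/
theorem armRightDensity_lt_half (t : ℝ) : armRightDensity t < 1 / 2 :=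
  (armRightDensity_le_slope (lt_add_one t)).trans_lt (slope_armFreeEnergy_lt_half (lt_add_one t))

/-- **`ρ⁻(t) < ½` for every `t`.** [cite: Beaton2014RotatedHoneycomb, §3.1, Proposition 7 (arXiv v3 p. 11)] -/
theorem armLeftDensity_lt_half (t : ℝ) : armLeftDensity t < 1 / 2 :=
  (armLeftDensity_le_armRightDensity t).trans_lt (armRightDensity_lt_half t)

end Literature.Probability.RandomPlanarGeometry.SAW.HexBW.Arm

namespace Literature.Probability.RandomPlanarGeometry.SAW.HV

open HexBW HexBW.Arm

variable {y : ℝ}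

/-! #### The strict chord bound for Beaton's `μ(y) = max(β_rot(y), μ)` -/

/-- **`μ(y') < √(y'/y) · μ(y)` for `0 < y < y'`** — the strict form of `rotSurfaceMu_le_sqrt_div_mul` (if `β_rot(y') ≤ μ` then
`μ(y') = μ ≤ μ(y) < √(y'/y) μ(y)`; otherwise `μ(y') = β_rot(y') < √(y'/y) β_rot(y) ≤ √(y'/y) μ(y)`).
[cite: Beaton2014RotatedHoneycomb, §3.1, Proposition 7 (arXiv v3 p. 11: "log-convex, non-decreasing function of log y … μ(y) ≥ max{μ, √y}")] -/
theorem rotSurfaceMu_lt_sqrt_div_mul (hy : 0 < y) {y' : ℝ} (hyy' : y < y') : rotSurfaceMu y' < Real.sqrt (y' / y) * rotSurfaceMu y := by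
  have hy' : 0 < y' := hy.trans hyy'
  have hr : 1 < Real.sqrt (y' / y) := by
    rw [show (1 : ℝ) = Real.sqrt 1 by simp]
    exact Real.sqrt_lt_sqrt zero_le_one ((one_lt_div hy).2 hyy')
  have hμy : 0 < rotSurfaceMu y := rotSurfaceMu_pos y
  rcases le_or_gt (armRate y') hexConnectiveConstant with hle | hgt
  · have h1 : rotSurfaceMu y' = hexConnectiveConstant := by rw [rotSurfaceMu, max_eq_right hle]
    rw [h1]
    calc hexConnectiveConstant ≤ rotSurfaceMu y := hexConnectiveConstant_le_rotSurfaceMu y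
      _ = 1 * rotSurfaceMu y := (one_mul _).symm
      _ < Real.sqrt (y' / y) * rotSurfaceMu y := mul_lt_mul_of_pos_right hr hμy
  · have h1 : rotSurfaceMu y' = armRate y' := by rw [rotSurfaceMu, max_eq_left hgt.le]
    rw [h1]
    calc armRate y' < Real.sqrt (y' / y) * armRate y := armRate_lt_sqrt_div_mul hy hyy'
      _ ≤ Real.sqrt (y' / y) * rotSurfaceMu y :=
        mul_le_mul_of_nonneg_left (armRate_le_rotSurfaceMu y) (Real.sqrt_nonneg _)

/-- **`μ(y)/√y` is STRICTLY decreasing on `(0, ∞)`** — the strict form of `antitoneOn_rotSurfaceMu_div_sqrt`.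
[cite: Beaton2014RotatedHoneycomb, §3.1, Proposition 7 (arXiv v3 p. 11: "μ(y) ≥ max{μ, √y}")] -/
theorem strictAntiOn_rotSurfaceMu_div_sqrt : StrictAntiOn (fun y : ℝ => rotSurfaceMu y / Real.sqrt y) (Set.Ioi 0) := by
  intro y hy y' hy' hyy'
  have hy0 : (0 : ℝ) < y := hy
  have hy0' : (0 : ℝ) < y' := hy'
  have h := rotSurfaceMu_lt_sqrt_div_mul hy0 hyy'
  have hs : 0 < Real.sqrt y := Real.sqrt_pos.2 hy0
  have hs' : 0 < Real.sqrt y' := Real.sqrt_pos.2 hy0'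
  show rotSurfaceMu y' / Real.sqrt y' < rotSurfaceMu y / Real.sqrt y
  rw [div_lt_div_iff₀ hs' hs]
  rw [Real.sqrt_div hy0'.le, div_mul_eq_mul_div, lt_div_iff₀ hs] at h
  linarith

/-! #### The same for Beaton's `μ(y) = max(β_rot(y), μ)`: for `y > 4` the two free energies coincide near `log y`, so the one-sided
densities of `t ↦ log μ(eᵗ)` are `ρ±(t)` and saturate at `½` -/

/-- For `t > log 4`, `log μ(eˢ) = κ_rot(s)` for all `s` near `t` (`μ(y) = β_rot(y)` for `y ≥ 4`, `rotSurfaceMu_eq_armRate_of_four_le`).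
[cite: Beaton2014RotatedHoneycomb, §3.1, Proposition 7 (arXiv v3 p. 11: "μ(y) ≥ max{μ, √y}"); DuminilCopinSmirnov2012, Theorem 1] -/
theorem log_rotSurfaceMu_exp_eventuallyEq_armFreeEnergy {t : ℝ} (ht : Real.log 4 < t) :
    (fun s : ℝ => Real.log (rotSurfaceMu (Real.exp s))) =ᶠ[𝓝 t] armFreeEnergy := by
  filter_upwards [Ioi_mem_nhds ht] with s hs
  have hs' : Real.log 4 < s := hs
  have h4 : (4 : ℝ) ≤ Real.exp s := ((Real.log_lt_iff_lt_exp (by norm_num)).1 hs').le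
  rw [armFreeEnergy_apply, rotSurfaceMu_eq_armRate_of_four_le h4]

/-- **For `y = eᵗ > 4` the right density of Beaton's `μ(y)` is `ρ⁺(t)`**: `d⁺/dt log μ(eᵗ) = ρ⁺(t)`.
[cite: Beaton2014RotatedHoneycomb, §3.1, Proposition 7 (arXiv v3 p. 11: "almost everywhere differentiable"); DuminilCopinSmirnov2012, Theorem 1] -/
theorem derivWithin_Ioi_log_rotSurfaceMu_exp_eq {t : ℝ} (ht : Real.log 4 < t) :
    derivWithin (fun s : ℝ => Real.log (rotSurfaceMu (Real.exp s))) (Set.Ioi t) t = armRightDensity t := by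
  have h := log_rotSurfaceMu_exp_eventuallyEq_armFreeEnergy ht
  rw [armRightDensity]
  exact (h.filter_mono nhdsWithin_le_nhds).derivWithin_eq h.self_of_nhds

/-- **For `y = eᵗ > 4` the left density of Beaton's `μ(y)` is `ρ⁻(t)`**: `d⁻/dt log μ(eᵗ) = ρ⁻(t)`.
[cite: Beaton2014RotatedHoneycomb, §3.1, Proposition 7 (arXiv v3 p. 11); DuminilCopinSmirnov2012, Theorem 1] -/
theorem derivWithin_Iio_log_rotSurfaceMu_exp_eq {t : ℝ} (ht : Real.log 4 < t) :
    derivWithin (fun s : ℝ => Real.log (rotSurfaceMu (Real.exp s))) (Set.Iio t) t = armLeftDensity t := by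
  have h := log_rotSurfaceMu_exp_eventuallyEq_armFreeEnergy ht
  rw [armLeftDensity]
  exact (h.filter_mono nhdsWithin_le_nhds).derivWithin_eq h.self_of_nhds

/-- **Saturation for Beaton's `μ(y)`: `d⁺/dt log μ(eᵗ) → ½` as `t → ∞`** — at large surface fugacity one vertex in two of the walks
counted by `μ(y)` lies in the surface, in density. [cite: Beaton2014RotatedHoneycomb, §3.1, Proposition 7 (arXiv v3 p. 11: "μ(y) ≥ max{μ, √y}"); BeatonBousquetMelouDeGierDuminilCopinGuttmann2014, §3.1 (arXiv v5 p. 10: "μ(y) ∼ √y")] -/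
theorem tendsto_derivWithin_Ioi_log_rotSurfaceMu_exp_atTop :
    Tendsto (fun t : ℝ => derivWithin (fun s : ℝ => Real.log (rotSurfaceMu (Real.exp s))) (Set.Ioi t) t) atTop (𝓝 (1 / 2)) := by
  refine tendsto_armRightDensity_atTop.congr' ?_
  filter_upwards [eventually_gt_atTop (Real.log 4)] with t ht
  exact (derivWithin_Ioi_log_rotSurfaceMu_exp_eq ht).symm

/-- **… and `d⁻/dt log μ(eᵗ) → ½` as `t → ∞`.** [cite: Beaton2014RotatedHoneycomb, §3.1, Proposition 7 (arXiv v3 p. 11: "μ(y) ≥ max{μ, √y}"); BeatonBousquetMelouDeGierDuminilCopinGuttmann2014, §3.1 (arXiv v5 p. 10: "μ(y) ∼ √y")] -/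
theorem tendsto_derivWithin_Iio_log_rotSurfaceMu_exp_atTop :
    Tendsto (fun t : ℝ => derivWithin (fun s : ℝ => Real.log (rotSurfaceMu (Real.exp s))) (Set.Iio t) t) atTop (𝓝 (1 / 2)) := by
  refine tendsto_armLeftDensity_atTop.congr' ?_
  filter_upwards [eventually_gt_atTop (Real.log 4)] with t ht
  exact (derivWithin_Iio_log_rotSurfaceMu_exp_eq ht).symm

end Literature.Probability.RandomPlanarGeometry.SAW.HV
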